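import Summits.CriticalPhenomena.PercolationContinuityZ3.Theorems.PercNearOneGluingAdditiveGluingVariants22625

/-!
# `PercNearOneGluing` · crux `AdditiveGluing` · line `peel` — closed rung of STUB 3 (good blocks stay good, winning-mass form)

Registered rung `stub_goodStaysGoodInsert` of the skeleton `Cruxes/AdditiveGluing/Lines/peel.lean` (crux item
stmt-CriticalPhenomena-4576).  It is STUB 3 `stub_goodStaysGoodBlock` ("good blocks stay good": for a block `T ∌ a₀` and any
vertex `x`, `D_T ≤ 0 ⟹ D_{T ∪ x} ≤ 0`) in the *winning-mass* form in which it is actually used and proved: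
`μ(a₀ ↔ b, a₀ ↮ T) ≤ μ(T ↔ b, a₀ ↮ T) ⟹ μ(a₀ ↔ b, a₀ ↮ T ∪ x) ≤ μ(T ∪ x ↔ b, a₀ ↮ T ∪ x)`.
The two forms are equivalent block by block via the landed reformulation `goodStaysGood_reform`
(`D_S ≤ 0 ⟺ μ(a₀↔b, a₀↮S) ≤ μ(S↔b, a₀↮S)`), and STUB 3 in its registered `D`-form is the landed theorem
`stub_goodStaysGoodBlock_var22625` (p165505); the proof below is that theorem transported through `goodStaysGood_reform`.
(The by-name alias `stub_goodStaysGoodBlock := stub_goodStaysGoodBlock_var22625` cannot be filed by a planner seat: as a new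
file it is a pure restatement of a landed declaration, and the variants file is prover/operator-only.)
[cite: VandenbergHaggstromKahn2005, Thm. 1.3 (p. 6); KozmaNitzan2024, Lemma 1 (pp. 5–6), §3.2 pp. 12–14]
-/

namespace Summit.CriticalPhenomena.PercolationContinuityZ3.Theorems

open MeasureTheory Set
open Literature.Probability.LatticeModels (prodBernoulli)
open Literature.Probability.Percolation (BondConfig openConn openConnIn openGraph openCluster)

noncomputable section
open Classical
open scoped BigOperators

/-- **Rung `stub_goodStaysGoodInsert` (line `peel`, STUB 3 in winning-mass form): good blocks stay good.**
For a block `T ∌ a₀` and any vertex `x`: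
`μ(a₀ ↔ b, a₀ ↮ T) ≤ μ(T ↔ b, a₀ ↮ T) ⟹ μ(a₀ ↔ b, a₀ ↮ T ∪ x) ≤ μ(T ∪ x ↔ b, a₀ ↮ T ∪ x)`.
Proof: `goodStaysGood_reform` into the `D`-form, `stub_goodStaysGoodBlock_var22625` (two applications of
van den Berg–Häggström–Kahn 2006 Thm 1.3 to the cluster of `a₀` given `{a₀ ↮ T}`), `goodStaysGood_reform` back.
[cite: VandenbergHaggstromKahn2005, Thm. 1.3 (p. 6); KozmaNitzan2024, Lemma 1 (pp. 5–6), §3.2 pp. 12–14] -/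
theorem stub_goodStaysGoodInsert :
    ∀ (n : ℕ) (u : Sym2 (Fin n) → unitInterval) (T : Finset (Fin n)) (b a₀ x : Fin n), a₀ ∉ T →
      (prodBernoulli u).real ((openConn a₀ b : Set (BondConfig (Fin n)))
            ∩ (⋃ v ∈ T, (openConn a₀ v : Set (BondConfig (Fin n))))ᶜ)
          ≤ (prodBernoulli u).real ((⋃ v ∈ T, (openConn v b : Set (BondConfig (Fin n))))
            ∩ (⋃ v ∈ T, (openConn a₀ v : Set (BondConfig (Fin n))))ᶜ) →
      (prodBernoulli u).real ((openConn a₀ b : Set (BondConfig (Fin n)))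
            ∩ (⋃ v ∈ insert x T, (openConn a₀ v : Set (BondConfig (Fin n))))ᶜ)
          ≤ (prodBernoulli u).real ((⋃ v ∈ insert x T, (openConn v b : Set (BondConfig (Fin n))))
            ∩ (⋃ v ∈ insert x T, (openConn a₀ v : Set (BondConfig (Fin n))))ᶜ) := by
  intro n u T b a₀ x ha₀T h
  exact (goodStaysGood_reform u (insert x T) b a₀).1
    (stub_goodStaysGoodBlock_var22625 n u T b a₀ x ha₀T ((goodStaysGood_reform u T b a₀).2 h))

end

end Summit.CriticalPhenomena.PercolationContinuityZ3.Theorems
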